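import Literature.NumberTheory.Transcendental.KZCalculusOver
import Literature.NumberTheory.Transcendental.KZCalculusProofs
import Literature.NumberTheory.Transcendental.SemialgebraicMapsProofs
import Literature.ModelTheory.ExponentialFields.WilkieConjectureProofs
import Literature.ModelTheory.ExponentialFields.RealExpFieldProofs

/-!
# `LogKernelConjecture` (stmt-KontsevichZagierPeriods-2837) — line `spectator-localisation`,
stub `stub_goodWeight` (E2, the good weight)

For an integral representation `s : KZ.IntegralRep 1` with `s.value = ∫_σ g ≠ 0` we produce a
rational box `[a, b] ⊆ σ` (`a < b`), a bounded weight `w : ℝ → ℝ` supported on `[a, b]` with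
`t ↦ w (t 0)` `ℚ`-semialgebraic on `ℝ¹`, and the normalisation `w (t 0) * g t = (b - a)⁻¹` on the
box. Proof:
(i) some superlevel set `A = {t ∈ σ | 1 < (k + 1) |g t|}` has positive Lebesgue measure (otherwise
`g = 0` a.e. on `σ` and `∫_σ g = 0`);
(ii) `A` is `ℚ`-semialgebraic (graph elimination, `IsSemialgebraicFunOn.isSemialgebraic_sep_lt`),
hence `ℝ`-semialgebraic (`IsSemialgebraic.baseChange`), so read on the line it is a finite union of
points and open intervals (`IsSemialgebraic.isFiniteUnionOfIntervals_preimage`); having positive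
measure it contains an open interval (`IsFiniteUnionOfIntervals.exists_finite_forall_Ioo_subset`),
hence a closed box with rational end points;
(iii) the weight is `w x = (b - a)⁻¹ (g x)⁻¹` on the box and `0` off it; it is bounded by
`(b - a)⁻¹ (k + 1)` and semialgebraic (gluing `IsSemialgebraicFunOn.union` of the constant `0` off
the box with a constant times the inverse of the non-vanishing semialgebraic `g` on the box, the
inverse being semialgebraic by graph elimination
`IsSemialgebraicFunOn.isSemialgebraic_setOf_snoc_mem` with the polynomial relation `y · g = 1`).
[folklore]
-/

noncomputable section

open MeasureTheory Set
open Literature.NumberTheory.Transcendental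
open Literature.ModelTheory.ExponentialFields (IsSemialgebraic IsFiniteUnionOfIntervals
  tarski_seidenberg_real_holds)

namespace Summit.KontsevichZagierPeriods.LiouvilleUnfolding.SpectatorLocalisation

/-! ## A superlevel set of positive measure -/

/-- If `∫_σ g ≠ 0` for an integral representation `r = (σ, g)`, then some superlevel set
`{t ∈ σ | 1 < (k + 1) |g t|}`, `k : ℕ`, has positive Lebesgue measure: otherwise their union
`{t ∈ σ | g t ≠ 0}` (Archimedes) is null, `g = 0` a.e. on `σ`, and `∫_σ g = 0`. [folklore] -/
theorem stub_goodWeight_exists_volume_ne_zero {n : ℕ} (r : KZ.IntegralRep n) (hr : r.value ≠ 0) :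
    ∃ k : ℕ, volume {t | t ∈ r.domain ∧ 1 < ((k : ℝ) + 1) * |r.integrand t|} ≠ 0 := by
  by_contra h
  push Not at h
  apply hr
  have hσ : MeasurableSet r.domain := KZ.IntegralRep.measurableSet_domain_holds r
  have hcover : {t | t ∈ r.domain ∧ r.integrand t ≠ 0} ⊆
      ⋃ k : ℕ, {t | t ∈ r.domain ∧ 1 < ((k : ℝ) + 1) * |r.integrand t|} := by
    rintro t ⟨ht, h0⟩
    obtain ⟨k, hk⟩ := exists_nat_gt |r.integrand t|⁻¹
    have hpos : 0 < |r.integrand t| := abs_pos.mpr h0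
    refine mem_iUnion.mpr ⟨k, ht, ?_⟩
    calc (1 : ℝ) = |r.integrand t|⁻¹ * |r.integrand t| := (inv_mul_cancel₀ hpos.ne').symm
      _ < ((k : ℝ) + 1) * |r.integrand t| :=
        mul_lt_mul_of_pos_right (hk.trans (lt_add_one _)) hpos
  have hnull : volume {t | t ∈ r.domain ∧ r.integrand t ≠ 0} = 0 :=
    measure_mono_null hcover (measure_iUnion_null h)
  have hae : (fun t => r.integrand t) =ᵐ[volume.restrict r.domain] 0 := by
    rw [Filter.EventuallyEq, ae_restrict_iff' hσ, ae_iff]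
    refine measure_mono_null (fun t ht => ?_) hnull
    simp only [Pi.zero_apply, mem_setOf_eq, Classical.not_imp] at ht
    exact ht
  exact integral_eq_zero_of_ae hae

/-- The superlevel sets `{t ∈ s | 1 < (k + 1) |f t|}` of a `ℚ`-semialgebraic function are
`ℚ`-semialgebraic (graph elimination, `IsSemialgebraicFunOn.isSemialgebraic_sep_lt` applied to
`-|f|`). [folklore] -/
theorem stub_goodWeight_isSemialgebraic_superlevel {m : ℕ} {s : Set (Fin m → ℝ)}
    {f : (Fin m → ℝ) → ℝ} (hf : IsSemialgebraicFunOn ℚ s f) (k : ℕ) :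
    IsSemialgebraic ℚ {x | x ∈ s ∧ 1 < ((k : ℝ) + 1) * |f x|} := by
  convert hf.abs.neg.isSemialgebraic_sep_lt tarski_seidenberg_real_holds (-1) k using 1
  ext x
  simp only [mem_setOf_eq, Pi.neg_apply, Int.cast_neg, Int.cast_one, mul_neg, neg_lt_neg_iff]

/-! ## From positive measure to a rational box -/

/-- A finite union of points and open intervals of positive Lebesgue measure contains a closed
interval with rational end points: off a finite (hence null) set every point has a neighbouring
open interval inside the set or inside its complement
(`IsFiniteUnionOfIntervals.exists_finite_forall_Ioo_subset`); pick such a point in the set.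
[folklore] -/
theorem stub_goodWeight_exists_Icc_subset {S : Set ℝ} (hS : IsFiniteUnionOfIntervals S)
    (hS0 : volume S ≠ 0) : ∃ a b : ℚ, a < b ∧ Icc (a : ℝ) b ⊆ S := by
  obtain ⟨F, hF, hloc⟩ := hS.exists_finite_forall_Ioo_subset
  have hSF : ¬ S ⊆ F := fun h => hS0 (measure_mono_null h (hF.measure_zero volume))
  obtain ⟨x, hxS, hxF⟩ := not_subset.mp hSF
  obtain ⟨p, q, hpx, hxq, h⟩ := hloc x hxF
  have hpq : Ioo p q ⊆ S := by
    rcases h with h | h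
    · exact h
    · exact absurd hxS (h ⟨hpx, hxq⟩)
  obtain ⟨a, hpa, hax⟩ := exists_rat_btwn hpx
  obtain ⟨b, hxb, hbq⟩ := exists_rat_btwn hxq
  exact ⟨a, b, Rat.cast_lt.mp (hax.trans hxb), (Icc_subset_Ioo hpa hbq).trans hpq⟩

/-- A `ℚ`-semialgebraic subset `A ⊆ ℝ¹` of positive Lebesgue measure contains a closed box
`{t | a ≤ t 0 ≤ b}` with rational `a < b`: `A` is `ℝ`-semialgebraic (`IsSemialgebraic.baseChange`),
so on the line it is a finite union of points and open intervals
(`IsSemialgebraic.isFiniteUnionOfIntervals_preimage`), of the same positive measure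
(`MeasureTheory.volume_preserving_funUnique`). [folklore] -/
theorem stub_goodWeight_exists_box {A : Set (Fin 1 → ℝ)} (hA : IsSemialgebraic ℚ A)
    (hA0 : volume A ≠ 0) :
    ∃ a b : ℚ, a < b ∧ ∀ t : Fin 1 → ℝ, (a : ℝ) ≤ t 0 → t 0 ≤ (b : ℝ) → t ∈ A := by
  -- a point of `ℝ¹` is the constant tuple with its value at `0`
  have hconst : ∀ t : Fin 1 → ℝ, (fun _ : Fin 1 => t 0) = t :=
    fun t => funext fun i => congrArg t (Subsingleton.elim 0 i)
  have hAR : IsSemialgebraic ℝ A := hA.baseChange ℝ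
  have hS : IsFiniteUnionOfIntervals ((fun r : ℝ => fun _ : Fin 1 => r) ⁻¹' A) :=
    hAR.isFiniteUnionOfIntervals_preimage
  have hS0 : volume ((fun r : ℝ => fun _ : Fin 1 => r) ⁻¹' A) ≠ 0 := by
    rw [← (volume_preserving_funUnique (Fin 1) ℝ).measure_preimage_equiv]
    have : (MeasurableEquiv.funUnique (Fin 1) ℝ) ⁻¹' ((fun r : ℝ => fun _ : Fin 1 => r) ⁻¹' A) =
        A := by
      ext t
      simp only [mem_preimage]
      rw [show (fun _ : Fin 1 => (MeasurableEquiv.funUnique (Fin 1) ℝ) t) = t from hconst t]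
    rwa [this]
  obtain ⟨a, b, hab, hIcc⟩ := stub_goodWeight_exists_Icc_subset hS hS0
  refine ⟨a, b, hab, fun t hat htb => ?_⟩
  have := hIcc ⟨hat, htb⟩
  rwa [mem_preimage, hconst] at this

/-! ## Semialgebraicity of the weight -/

/-- The inverse of a non-vanishing `ℚ`-semialgebraic function is `ℚ`-semialgebraic: its graph is
`{(x, y) | x ∈ s, (x, y, f x) ∈ {y · f = 1}}` (graph elimination,
`IsSemialgebraicFunOn.isSemialgebraic_setOf_snoc_mem`). [folklore] -/
theorem stub_goodWeight_inv {m : ℕ} {s : Set (Fin m → ℝ)} {f : (Fin m → ℝ) → ℝ}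
    (hf : IsSemialgebraicFunOn ℚ s f) (h0 : ∀ x ∈ s, f x ≠ 0) :
    IsSemialgebraicFunOn ℚ s (fun x => (f x)⁻¹) := by
  have hT : IsSemialgebraic ℚ {u : Fin (m + 2) → ℝ |
      u (Fin.castSucc (Fin.last m)) * u (Fin.last (m + 1)) = 1} := by
    have := Literature.ModelTheory.ExponentialFields.isSemialgebraic_setOf_eval_eq_zero (k := ℚ)
      (R := ℝ) (MvPolynomial.X (Fin.castSucc (Fin.last m)) * MvPolynomial.X (Fin.last (m + 1)) -
        1 : MvPolynomial (Fin (m + 2)) ℚ)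
    simpa [sub_eq_zero] using this
  rw [isSemialgebraicFunOn_iff]
  convert hf.isSemialgebraic_setOf_snoc_mem tarski_seidenberg_real_holds hT using 1
  ext v
  simp only [mem_setOf_eq, Fin.snoc_castSucc, Fin.snoc_last]
  exact and_congr_right fun hv => (mul_eq_one_iff_eq_inv₀ (h0 _ hv)).symm

/-- **The weight is semialgebraic.** If `g` is `ℚ`-semialgebraic on `σ ⊆ ℝ¹` and non-vanishing on
the rational box `{a ≤ t 0 ≤ b} ⊆ σ`, then `t ↦ q⁻¹ (g t)⁻¹` on the box, `0` off it, is a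
`ℚ`-semialgebraic function on `ℝ¹` (`IsSemialgebraicFunOn.union` of a constant times
`stub_goodWeight_inv` on the box and of the constant `0` on its complement). [folklore] -/
theorem stub_goodWeight_weight_isSemialgebraicFunOn {σ : Set (Fin 1 → ℝ)} {g : (Fin 1 → ℝ) → ℝ}
    (hg : IsSemialgebraicFunOn ℚ σ g) (a b q : ℚ)
    (hbox : ∀ t : Fin 1 → ℝ, (a : ℝ) ≤ t 0 ∧ t 0 ≤ (b : ℝ) → t ∈ σ ∧ g t ≠ 0) :
    IsSemialgebraicFunOn ℚ (Set.univ : Set (Fin 1 → ℝ)) (fun t : Fin 1 → ℝ =>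
      if (a : ℝ) ≤ t 0 ∧ t 0 ≤ (b : ℝ) then (q : ℝ)⁻¹ * (g (fun _ : Fin 1 => t 0))⁻¹ else 0) := by
  -- a point of `ℝ¹` is the constant tuple with its value at `0`
  have hg' : ∀ t : Fin 1 → ℝ, g (fun _ : Fin 1 => t 0) = g t :=
    fun t => congrArg g (funext fun i => congrArg t (Subsingleton.elim 0 i))
  -- the box is `ℚ`-semialgebraic
  have hB : IsSemialgebraic ℚ {t : Fin 1 → ℝ | (a : ℝ) ≤ t 0 ∧ t 0 ≤ (b : ℝ)} := by
    have h1 := Literature.ModelTheory.ExponentialFields.isSemialgebraic_setOf_eval_le (k := ℚ)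
      (R := ℝ) (MvPolynomial.C a : MvPolynomial (Fin 1) ℚ) (MvPolynomial.X 0)
    have h2 := Literature.ModelTheory.ExponentialFields.isSemialgebraic_setOf_eval_le (k := ℚ)
      (R := ℝ) (MvPolynomial.X 0 : MvPolynomial (Fin 1) ℚ) (MvPolynomial.C b)
    simp only [MvPolynomial.aeval_C, MvPolynomial.aeval_X, eq_ratCast] at h1 h2
    exact h1.inter h2
  have hBσ : {t : Fin 1 → ℝ | (a : ℝ) ≤ t 0 ∧ t 0 ≤ (b : ℝ)} ⊆ σ := fun t ht => (hbox t ht).1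
  -- on the box: a rational constant times the inverse of `g`
  have hq : IsSemialgebraicFunOn ℚ {t : Fin 1 → ℝ | (a : ℝ) ≤ t 0 ∧ t 0 ≤ (b : ℝ)}
      (fun _ => (q : ℝ)⁻¹) :=
    (isSemialgebraicFunOn_aeval hB (MvPolynomial.C q⁻¹)).congr fun x _ => by simp
  have hinv : IsSemialgebraicFunOn ℚ {t : Fin 1 → ℝ | (a : ℝ) ≤ t 0 ∧ t 0 ≤ (b : ℝ)}
      (fun t => (g t)⁻¹) :=
    stub_goodWeight_inv (hg.mono hBσ hB) fun t ht => (hbox t ht).2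
  have hmul := IsSemialgebraicFunOn.mul_holds hq hinv
  -- off the box: the constant `0`
  have hzero : IsSemialgebraicFunOn ℚ {t : Fin 1 → ℝ | (a : ℝ) ≤ t 0 ∧ t 0 ≤ (b : ℝ)}ᶜ
      (fun _ => (0 : ℝ)) :=
    (isSemialgebraicFunOn_aeval hB.compl 0).congr fun x _ => by simp
  rw [← Set.union_compl_self {t : Fin 1 → ℝ | (a : ℝ) ≤ t 0 ∧ t 0 ≤ (b : ℝ)}]
  refine IsSemialgebraicFunOn.union hmul hzero (fun t ht => ?_) (fun t ht => ?_)
  · have ht' : (a : ℝ) ≤ t 0 ∧ t 0 ≤ (b : ℝ) := ht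
    simp only [if_pos ht', Pi.mul_apply, hg' t]
  · have ht' : ¬ ((a : ℝ) ≤ t 0 ∧ t 0 ≤ (b : ℝ)) := ht
    simp only [if_neg ht']

/-! ## The stub -/

/-- **Stub E2 — the good weight.** For `s : KZ.IntegralRep 1` with `s.value = ∫_σ g ≠ 0` there are
rationals `a < b`, a weight `w : ℝ → ℝ` and a bound `M` with: `t ↦ w (t 0)` `ℚ`-semialgebraic on
`ℝ¹`, `|w| ≤ M`, the box `{a ≤ t 0 ≤ b}` inside `σ` with `w (t 0) * g t = (b - a)⁻¹` there, and
`w = 0` off `[a, b]`. Take a superlevel set `{t ∈ σ | 1 < (k + 1) |g t|}` of positive measure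
(`stub_goodWeight_exists_volume_ne_zero`), a rational box inside it
(`stub_goodWeight_exists_box`), and `w x = (b - a)⁻¹ (g x)⁻¹` on `[a, b]`, `0` elsewhere
(`stub_goodWeight_weight_isSemialgebraicFunOn`; bound `M = (b - a)⁻¹ (k + 1)`). [folklore] -/
theorem stub_goodWeight : ∀ (s : Literature.NumberTheory.Transcendental.KZ.IntegralRep 1), s.value ≠ 0 → ∃ (a b : ℚ) (w : ℝ → ℝ) (M : ℝ), a < b ∧ Literature.NumberTheory.Transcendental.IsSemialgebraicFunOn ℚ (Set.univ : Set (Fin 1 → ℝ)) (fun t => w (t 0)) ∧ (∀ x : ℝ, |w x| ≤ M) ∧ (∀ t : Fin 1 → ℝ, (a : ℝ) ≤ t 0 → t 0 ≤ (b : ℝ) → t ∈ s.domain ∧ w (t 0) * s.integrand t = ((b - a : ℚ) : ℝ)⁻¹) ∧ (∀ x : ℝ, (x < (a : ℝ) ∨ (b : ℝ) < x) → w x = 0) := by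
  intro s hs
  -- (i)–(ii) a rational box inside a superlevel set of the integrand
  obtain ⟨k, hk⟩ := stub_goodWeight_exists_volume_ne_zero s hs
  obtain ⟨a, b, hab, hboxA⟩ := stub_goodWeight_exists_box
    (stub_goodWeight_isSemialgebraic_superlevel s.isSemialgebraicFunOn_integrand k) hk
  have hbox : ∀ t : Fin 1 → ℝ, (a : ℝ) ≤ t 0 ∧ t 0 ≤ (b : ℝ) →
      t ∈ s.domain ∧ s.integrand t ≠ 0 := by
    intro t ht
    obtain ⟨hσ, hlt⟩ := hboxA t ht.1 ht.2
    refine ⟨hσ, fun h0 => ?_⟩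
    rw [h0, abs_zero, mul_zero] at hlt
    exact absurd hlt (not_lt.mpr zero_le_one)
  have hC : (0 : ℝ) ≤ ((b - a : ℚ) : ℝ)⁻¹ :=
    inv_nonneg.mpr (Rat.cast_nonneg.mpr (sub_nonneg.mpr hab.le))
  -- (iii) the weight
  refine ⟨a, b, fun x => if (a : ℝ) ≤ x ∧ x ≤ (b : ℝ) then
      ((b - a : ℚ) : ℝ)⁻¹ * (s.integrand (fun _ : Fin 1 => x))⁻¹ else 0,
    ((b - a : ℚ) : ℝ)⁻¹ * ((k : ℝ) + 1), hab, ?_, fun x => ?_, fun t hat htb => ?_, fun x hx => ?_⟩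
  · -- semialgebraicity
    exact stub_goodWeight_weight_isSemialgebraicFunOn s.isSemialgebraicFunOn_integrand a b (b - a)
      hbox
  · -- the bound
    dsimp only
    split_ifs with hx
    · obtain ⟨-, hlt⟩ := hboxA (fun _ : Fin 1 => x) hx.1 hx.2
      have hpos : 0 < |s.integrand fun _ : Fin 1 => x| := by
        refine (abs_nonneg _).lt_of_ne' fun h0 => ?_
        rw [h0, mul_zero] at hlt
        exact absurd hlt (not_lt.mpr zero_le_one)
      rw [abs_mul, abs_of_nonneg hC, abs_inv]
      exact mul_le_mul_of_nonneg_left ((inv_lt_iff_one_lt_mul₀ hpos).2 hlt).le hC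
    · rw [abs_zero]
      exact mul_nonneg hC (by positivity)
  · -- the normalisation on the box
    refine ⟨(hbox t ⟨hat, htb⟩).1, ?_⟩
    dsimp only
    have hconst : (fun _ : Fin 1 => t 0) = t := funext fun i => congrArg t (Subsingleton.elim 0 i)
    rw [if_pos ⟨hat, htb⟩, hconst, inv_mul_cancel_right₀ (hbox t ⟨hat, htb⟩).2]
  · -- vanishing off the box
    dsimp only
    rw [if_neg]
    rintro ⟨h1, h2⟩
    rcases hx with hx | hx
    · exact absurd h1 (not_le.mpr hx)
    · exact absurd h2 (not_le.mpr hx)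

end Summit.KontsevichZagierPeriods.LiouvilleUnfolding.SpectatorLocalisation

end
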